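import Summits.NavierStokesRegularity.NavierStokesRegularity.Theorems.HubbleDynamoNoSelfExcitedDynamoFloorWithTail
import Summits.NavierStokesRegularity.NavierStokesRegularity.Theorems.HubbleDynamoNoSelfExcitedDynamoStubBeltramiRegime
import HarnessLib

/-!
# Crux `NoSelfExcitedDynamo` (stmt-NavierStokesRegularity-1934), line `registered`, skeleton v20:
# bridges for the open stub G⁶ `stub_noRecurrentProfileAboveFloorWithTailNonBeltrami`

Theorems file (`--supports stmt-NavierStokesRegularity-1934`; theorems only, sorry-free). Lead c4
reshaped the open stub G⁵ (`stub_noRecurrentProfileAboveFloorWithTail`, v17/v18, bridges in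
`…FloorWithTail.lean` p173343) into G⁵ ⇐ B1 ∧ G⁶ with B1 LANDED:

* B1 `stub_beltramiRegime` (p173916; `S = ∫⟪W × Ω, curl Ω⟫`, only the non-Beltrami part of
  `curl Ω` stretches): an eternal profile-class solution with `‖W‖ ≤ K`, `D_⊥ ≤ βD` at every time and
  `βK² < 1` vanishes (`β = 1` is the Backus regime p150871);

and the open residue G⁶ = G⁵ + "(iv) NOT nearly force-free relative to the amplitude: for every
`β ≥ 0`, `K` with `βK² < 1` and `‖W‖ ≤ K`, at some time `βD < D_⊥`". This file records: G⁶ ⇒ G⁵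
(`noRecurrentProfileAboveFloorWithTail_of_nonBeltrami`, the skeleton's composition), G⁶ ⇒ crux,
crux ⇒ G⁶ (so G⁶ ⇔ G⁵ ⇔ G⁗ ⇔ G″ ⇔ crux), and node (`RecurrentLiouville`, stmt-1589) ⇒ G⁶.
-/

noncomputable section

-- the mandated stub namespace repeats `NavierStokesRegularity` (tree precedent for this crux's stubs)
set_option linter.dupNamespace false

namespace Summit.NavierStokesRegularity.NavierStokesRegularity.Theorems.NoSelfExcitedDynamo.Registered

open Set MeasureTheory Filter Topology InnerProductSpace Function
open scoped RealInnerProductSpace Laplacian ContDiff NNReal ENNReal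
open Literature.Analysis.FluidPDE

/-- **G⁶ ⇒ G⁵** (sub-goal `noRecurrentProfileAboveFloorWithTail_of_nonBeltrami`; the composition of
skeleton v19/v20): either some `β ≥ 0`, `K` with `βK² < 1`, `‖W‖ ≤ K` and `D_⊥ ≤ βD` at all times
exist (B1 `stub_beltramiRegime` kills the solution), or clause (iv) of G⁶ holds (G⁶ kills it). -/
theorem noRecurrentProfileAboveFloorWithTail_of_nonBeltrami
    (hG6 : ∀ (W : ℝ → EuclideanSpace ℝ (Fin 3) → EuclideanSpace ℝ (Fin 3)) (Q : ℝ → EuclideanSpace ℝ (Fin 3) → ℝ),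
      IsBackwardLeraySolutionOn univ 1 W Q →
      (∀ k : ℕ, ∃ K : ℝ, ∀ s y, (1 + ‖y‖) ^ (k + 1) * ‖iteratedFDeriv ℝ k (W s) y‖ ≤ K) →
      (∀ ε : ℝ, 0 < ε → ∀ R : ℝ, ∃ L : ℝ, 0 < L ∧ ∀ a : ℝ, ∃ σ ∈ Icc a (a + L),
        ∀ s ∈ Icc (-R) R, ∀ y ∈ Metric.closedBall (0 : EuclideanSpace ℝ (Fin 3)) R,
          ‖W (s + σ) y - W s y‖ < ε) →
      (∀ s, 64 / 27 ≤ ((SNormLESNormFDerivOfEqConst (EuclideanSpace ℝ (Fin 3))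
            (volume : Measure (EuclideanSpace ℝ (Fin 3))) 2 : ℝ≥0) : ℝ) ^ 6 *
          (∫ y, ‖curl (W s) y‖ ^ 2) ^ 2) →
      (∀ s₀ : ℝ, ∃ φ : EuclideanSpace ℝ (Fin 3) → EuclideanSpace ℝ (Fin 3),
        Literature.Analysis.FunctionSpaces.IsTestFunctionOn
            (⊤ : TopologicalSpace.Opens (EuclideanSpace ℝ (Fin 3))) φ ∧
          ¬ Tendsto (fun lam : ℝ => ∫ y, ⟪lam • W s₀ (lam • y), φ y⟫) atTop (𝓝 0)) →
      (∀ μ : ℝ, μ < 1 → ∃ s y, ∃ v : EuclideanSpace ℝ (Fin 3), μ * ‖v‖ ^ 2 < ⟪v, fderiv ℝ (W s) y v⟫) →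
      (∀ β K : ℝ, 0 ≤ β → β * K ^ 2 < 1 → (∀ s y, ‖W s y‖ ≤ K) →
        ∃ s, β * ∫ y, ‖curl (curl (W s)) y‖ ^ 2 <
          ∫ y, (‖curl (curl (W s)) y‖ ^ 2 -
            ⟪curl (curl (W s)) y, curl (W s) y⟫ ^ 2 / ‖curl (W s) y‖ ^ 2)) →
      ∀ s y, W s y = 0) :
    ∀ (W : ℝ → EuclideanSpace ℝ (Fin 3) → EuclideanSpace ℝ (Fin 3)) (Q : ℝ → EuclideanSpace ℝ (Fin 3) → ℝ),
      IsBackwardLeraySolutionOn univ 1 W Q →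
      (∀ k : ℕ, ∃ K : ℝ, ∀ s y, (1 + ‖y‖) ^ (k + 1) * ‖iteratedFDeriv ℝ k (W s) y‖ ≤ K) →
      (∀ ε : ℝ, 0 < ε → ∀ R : ℝ, ∃ L : ℝ, 0 < L ∧ ∀ a : ℝ, ∃ σ ∈ Icc a (a + L),
        ∀ s ∈ Icc (-R) R, ∀ y ∈ Metric.closedBall (0 : EuclideanSpace ℝ (Fin 3)) R,
          ‖W (s + σ) y - W s y‖ < ε) →
      (∀ s, 64 / 27 ≤ ((SNormLESNormFDerivOfEqConst (EuclideanSpace ℝ (Fin 3))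
            (volume : Measure (EuclideanSpace ℝ (Fin 3))) 2 : ℝ≥0) : ℝ) ^ 6 *
          (∫ y, ‖curl (W s) y‖ ^ 2) ^ 2) →
      (∀ s₀ : ℝ, ∃ φ : EuclideanSpace ℝ (Fin 3) → EuclideanSpace ℝ (Fin 3),
        Literature.Analysis.FunctionSpaces.IsTestFunctionOn
            (⊤ : TopologicalSpace.Opens (EuclideanSpace ℝ (Fin 3))) φ ∧
          ¬ Tendsto (fun lam : ℝ => ∫ y, ⟪lam • W s₀ (lam • y), φ y⟫) atTop (𝓝 0)) →
      (∀ μ : ℝ, μ < 1 → ∃ s y, ∃ v : EuclideanSpace ℝ (Fin 3), μ * ‖v‖ ^ 2 < ⟪v, fderiv ℝ (W s) y v⟫) →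
      ∀ s y, W s y = 0 := by
  intro W Q hW hprof hrec hfloor htail hstrain
  by_cases hbel : ∃ β K : ℝ, 0 ≤ β ∧ β * K ^ 2 < 1 ∧ (∀ s y, ‖W s y‖ ≤ K) ∧
      ∀ s, ∫ y, (‖curl (curl (W s)) y‖ ^ 2 -
          ⟪curl (curl (W s)) y, curl (W s) y⟫ ^ 2 / ‖curl (W s) y‖ ^ 2) ≤
        β * ∫ y, ‖curl (curl (W s)) y‖ ^ 2
  · exact stub_beltramiRegime W Q hW hprof hbel
  push Not at hbel
  exact hG6 W Q hW hprof hrec hfloor htail hstrain (fun β K hβ hβK hK => hbel β K hβ hβK hK)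

/-- **G⁶ ⇒ crux** (sub-goal `noSelfExcitedDynamo_of_nonBeltrami`; the conclusion is the crux
`NoSelfExcitedDynamo` unfolded), through G⁵ (p173343), G⁗ (p166766) and G″ (p160780). -/
theorem noSelfExcitedDynamo_of_nonBeltrami :
    (∀ (W : ℝ → EuclideanSpace ℝ (Fin 3) → EuclideanSpace ℝ (Fin 3)) (Q : ℝ → EuclideanSpace ℝ (Fin 3) → ℝ),
      IsBackwardLeraySolutionOn univ 1 W Q →
      (∀ k : ℕ, ∃ K : ℝ, ∀ s y, (1 + ‖y‖) ^ (k + 1) * ‖iteratedFDeriv ℝ k (W s) y‖ ≤ K) →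
      (∀ ε : ℝ, 0 < ε → ∀ R : ℝ, ∃ L : ℝ, 0 < L ∧ ∀ a : ℝ, ∃ σ ∈ Icc a (a + L),
        ∀ s ∈ Icc (-R) R, ∀ y ∈ Metric.closedBall (0 : EuclideanSpace ℝ (Fin 3)) R,
          ‖W (s + σ) y - W s y‖ < ε) →
      (∀ s, 64 / 27 ≤ ((SNormLESNormFDerivOfEqConst (EuclideanSpace ℝ (Fin 3))
            (volume : Measure (EuclideanSpace ℝ (Fin 3))) 2 : ℝ≥0) : ℝ) ^ 6 *
          (∫ y, ‖curl (W s) y‖ ^ 2) ^ 2) →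
      (∀ s₀ : ℝ, ∃ φ : EuclideanSpace ℝ (Fin 3) → EuclideanSpace ℝ (Fin 3),
        Literature.Analysis.FunctionSpaces.IsTestFunctionOn
            (⊤ : TopologicalSpace.Opens (EuclideanSpace ℝ (Fin 3))) φ ∧
          ¬ Tendsto (fun lam : ℝ => ∫ y, ⟪lam • W s₀ (lam • y), φ y⟫) atTop (𝓝 0)) →
      (∀ μ : ℝ, μ < 1 → ∃ s y, ∃ v : EuclideanSpace ℝ (Fin 3), μ * ‖v‖ ^ 2 < ⟪v, fderiv ℝ (W s) y v⟫) →
      (∀ β K : ℝ, 0 ≤ β → β * K ^ 2 < 1 → (∀ s y, ‖W s y‖ ≤ K) →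
        ∃ s, β * ∫ y, ‖curl (curl (W s)) y‖ ^ 2 <
          ∫ y, (‖curl (curl (W s)) y‖ ^ 2 -
            ⟪curl (curl (W s)) y, curl (W s) y⟫ ^ 2 / ‖curl (W s) y‖ ^ 2)) →
      ∀ s y, W s y = 0) →
    ∀ u : ℝ → EuclideanSpace ℝ (Fin 3) → EuclideanSpace ℝ (Fin 3),
      IsBoundedAncientMildSolution 1 u →
      (∀ t < 0, AEStronglyMeasurable (u t) volume) → (∃ C : ℝ, HasTypeIDecay C u) →
      ∀ t < 0, u t =ᵐ[volume] (0 : EuclideanSpace ℝ (Fin 3) → EuclideanSpace ℝ (Fin 3)) := fun hG6 =>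
  noSelfExcitedDynamo_of_noRecurrentProfileAboveFloorWithTail
    (noRecurrentProfileAboveFloorWithTail_of_nonBeltrami hG6)

/-- **crux ⇒ G⁶** (sub-goal `nonBeltrami_of_noSelfExcitedDynamo`; hypothesis = the crux unfolded),
through p173343. So G⁶ ⇔ G⁵ ⇔ G⁗ ⇔ G″ ⇔ crux: the reshape loses nothing. -/
theorem nonBeltrami_of_noSelfExcitedDynamo :
    (∀ u : ℝ → EuclideanSpace ℝ (Fin 3) → EuclideanSpace ℝ (Fin 3),
      IsBoundedAncientMildSolution 1 u →
      (∀ t < 0, AEStronglyMeasurable (u t) volume) → (∃ C : ℝ, HasTypeIDecay C u) →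
      ∀ t < 0, u t =ᵐ[volume] (0 : EuclideanSpace ℝ (Fin 3) → EuclideanSpace ℝ (Fin 3))) →
    ∀ (W : ℝ → EuclideanSpace ℝ (Fin 3) → EuclideanSpace ℝ (Fin 3)) (Q : ℝ → EuclideanSpace ℝ (Fin 3) → ℝ),
      IsBackwardLeraySolutionOn univ 1 W Q →
      (∀ k : ℕ, ∃ K : ℝ, ∀ s y, (1 + ‖y‖) ^ (k + 1) * ‖iteratedFDeriv ℝ k (W s) y‖ ≤ K) →
      (∀ ε : ℝ, 0 < ε → ∀ R : ℝ, ∃ L : ℝ, 0 < L ∧ ∀ a : ℝ, ∃ σ ∈ Icc a (a + L),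
        ∀ s ∈ Icc (-R) R, ∀ y ∈ Metric.closedBall (0 : EuclideanSpace ℝ (Fin 3)) R,
          ‖W (s + σ) y - W s y‖ < ε) →
      (∀ s, 64 / 27 ≤ ((SNormLESNormFDerivOfEqConst (EuclideanSpace ℝ (Fin 3))
            (volume : Measure (EuclideanSpace ℝ (Fin 3))) 2 : ℝ≥0) : ℝ) ^ 6 *
          (∫ y, ‖curl (W s) y‖ ^ 2) ^ 2) →
      (∀ s₀ : ℝ, ∃ φ : EuclideanSpace ℝ (Fin 3) → EuclideanSpace ℝ (Fin 3),
        Literature.Analysis.FunctionSpaces.IsTestFunctionOn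
            (⊤ : TopologicalSpace.Opens (EuclideanSpace ℝ (Fin 3))) φ ∧
          ¬ Tendsto (fun lam : ℝ => ∫ y, ⟪lam • W s₀ (lam • y), φ y⟫) atTop (𝓝 0)) →
      (∀ μ : ℝ, μ < 1 → ∃ s y, ∃ v : EuclideanSpace ℝ (Fin 3), μ * ‖v‖ ^ 2 < ⟪v, fderiv ℝ (W s) y v⟫) →
      (∀ β K : ℝ, 0 ≤ β → β * K ^ 2 < 1 → (∀ s y, ‖W s y‖ ≤ K) →
        ∃ s, β * ∫ y, ‖curl (curl (W s)) y‖ ^ 2 <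
          ∫ y, (‖curl (curl (W s)) y‖ ^ 2 -
            ⟪curl (curl (W s)) y, curl (W s) y⟫ ^ 2 / ‖curl (W s) y‖ ^ 2)) →
      ∀ s y, W s y = 0 :=
  fun hcrux W Q hW hprof hrec hfloor htail hstrain _ =>
    noRecurrentProfileAboveFloorWithTail_of_noSelfExcitedDynamo hcrux W Q hW hprof hrec hfloor htail hstrain

/-- **node ⇒ G⁶** (sub-goal `nonBeltrami_of_recurrentLiouville`): the node crux `RecurrentLiouville`
(stmt-NavierStokesRegularity-1589) implies the line's open stub, through the crux (p157812, p173343). -/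
theorem nonBeltrami_of_recurrentLiouville (h : Theses.SqueezeCycle.RecurrentLiouville) :
    ∀ (W : ℝ → EuclideanSpace ℝ (Fin 3) → EuclideanSpace ℝ (Fin 3)) (Q : ℝ → EuclideanSpace ℝ (Fin 3) → ℝ),
      IsBackwardLeraySolutionOn univ 1 W Q →
      (∀ k : ℕ, ∃ K : ℝ, ∀ s y, (1 + ‖y‖) ^ (k + 1) * ‖iteratedFDeriv ℝ k (W s) y‖ ≤ K) →
      (∀ ε : ℝ, 0 < ε → ∀ R : ℝ, ∃ L : ℝ, 0 < L ∧ ∀ a : ℝ, ∃ σ ∈ Icc a (a + L),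
        ∀ s ∈ Icc (-R) R, ∀ y ∈ Metric.closedBall (0 : EuclideanSpace ℝ (Fin 3)) R,
          ‖W (s + σ) y - W s y‖ < ε) →
      (∀ s, 64 / 27 ≤ ((SNormLESNormFDerivOfEqConst (EuclideanSpace ℝ (Fin 3))
            (volume : Measure (EuclideanSpace ℝ (Fin 3))) 2 : ℝ≥0) : ℝ) ^ 6 *
          (∫ y, ‖curl (W s) y‖ ^ 2) ^ 2) →
      (∀ s₀ : ℝ, ∃ φ : EuclideanSpace ℝ (Fin 3) → EuclideanSpace ℝ (Fin 3),
        Literature.Analysis.FunctionSpaces.IsTestFunctionOn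
            (⊤ : TopologicalSpace.Opens (EuclideanSpace ℝ (Fin 3))) φ ∧
          ¬ Tendsto (fun lam : ℝ => ∫ y, ⟪lam • W s₀ (lam • y), φ y⟫) atTop (𝓝 0)) →
      (∀ μ : ℝ, μ < 1 → ∃ s y, ∃ v : EuclideanSpace ℝ (Fin 3), μ * ‖v‖ ^ 2 < ⟪v, fderiv ℝ (W s) y v⟫) →
      (∀ β K : ℝ, 0 ≤ β → β * K ^ 2 < 1 → (∀ s y, ‖W s y‖ ≤ K) →
        ∃ s, β * ∫ y, ‖curl (curl (W s)) y‖ ^ 2 <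
          ∫ y, (‖curl (curl (W s)) y‖ ^ 2 -
            ⟪curl (curl (W s)) y, curl (W s) y⟫ ^ 2 / ‖curl (W s) y‖ ^ 2)) →
      ∀ s y, W s y = 0 :=
  fun W Q hW hprof hrec hfloor htail hstrain _ =>
    noRecurrentProfileAboveFloorWithTail_of_recurrentLiouville h W Q hW hprof hrec hfloor htail hstrain

end Summit.NavierStokesRegularity.NavierStokesRegularity.Theorems.NoSelfExcitedDynamo.Registered

end
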